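import Summits.CriticalPhenomena.PercolationContinuityZ3.Theorems.Transplant.SkelPhiWinChainS
import Summits.CriticalPhenomena.PercolationContinuityZ3.Theorems.Transplant.SkelKitResidues
import HarnessLib

/-!
# D″ node, (R) layer, file 1 (R-RECUT-PLAN §2 step 1; DPRIME-SCOPE p3 addenda K/M, rulings R1/R2): the ROOT PROBE RESIDUE in
# SCHEDULE-CHAIN form, `Skelφ.RootOblS`, over p1-g9's schedule-generic window chain `(𝒲 : Skelφ.PlanarWindow (winGraph G c Rπ))
# (Sc : ChainPlanar.Schedule) (P : Skelφ.WinChainData V)` (`SkelPhiWinChainS`), REPACKAGED into stmt-g7's node-facing `Skel.RootOblT`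
# (`SkelKitResidues`, Φ-free) with no further hypothesis — the φ-level, schedule-generic successor of stmt-g7's `Skel.RootOblA` /
# `Skel.rootOblT_of_rootOblA` (`SkelAdvPackaging`, typed over `Φ : PlanarSkeletonConc G` and the straight run `Skel.WinAdvData`)

builds on p205010 (kernel theorem, internal audit signed; external expert review pending) — nothing in this file uses p205010.
Status sentence (coordinator 2026-08-20T04:30Z): "θ(p_c) = 0 on ℤ^d, all d ≥ 2 — kernel-verified (Lean 4/Mathlib, standard axioms); internal
adversarial audit SIGNED 2026-08-20 04:29Z; external expert review pending."
Lane `prim-bschramm-*`, seat `prim-bschramm-p2` (gen 8; (R) = p2 lineage under D″); helper file (`--supports stmt-CriticalPhenomena-4575`).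

WHY A NEW PACKAGING.  The node-facing root residue `Skel.RootOblT G S Δ' δr` (an abstract linked chain of target steps in some window graph
`winGraph G c Rπ`, Φ-free, the `RootHolds` head of p3-g7's `SkelSignChoice`) is REUSED by the D″ closure.  Its straight-run producer
`Skel.RootOblA Φ …` is typed over `Φ : PlanarSkeletonConc G` and the square-cell straight run `Skel.WinAdvData` (`stepD Φ`, `coreT Φ`), so it
cannot serve a node over the weaker `PlanarSkeletonSign`; under D″ the root chain is p1-g9's chain of a PLANAR SCHEDULE (`ChainPlanar.Schedule`,
instances `Band.scheduleR` for the root band run, `Loc.schedule ∘ …` for corridors) over a PLANAR WINDOW of the exploration graph.  This file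
states the residue once over `(𝒲, Sc, P)` — generic in the planar window, so the def carries no dictionary hypothesis — and does the
`Fin (Sc.N + 1)`-bookkeeping into `Skel.RootOblT` once (the transfer to a dominating event, ex-`lt_real_of_advChain`, is already p1-g9's
`Skelφ.WinChainData.lt_real_of_chainS`).
* **`Skelφ.RootOblS G S Δ' δr`** — for every direction `du`: a window graph `winGraph G c Rπ`, a planar window `𝒲` over it, a schedule `Sc`,
  chain data `P` sourced at the scheme's root, a sub-world `U' ⊆ Q_0 ∪ E_{0,du}` containing the root, under the root law cut to `U'`
  (`S.W0sub G U'`): `Rlev + 1 ≤ R'`, rim parts inside the regions, nonempty true targets, per step `k ≤ Sc.N` the subbox property, the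
  support facts, the source off the region, Step II's count and the per-level kit clause at accuracy `δr Sc.N` towards the enlarged target,
  the rim excess `≤ η ≤ δr Sc.N / 2`, the first hop `1 − δr Sc.N < P(root ↔ B₀)` towards some `B₀ ⊆ X^{(0)}_0`, and the last core inside
  `M_{a₀}(0 + du)`;
* **`Skelφ.rootOblT_of_rootOblS`** (pure repackaging via `WinChainData.stepA / kitsAt_stepA`) and **`Skelφ.rootObl_of_rootOblS`** (with the chain
  property of every length, `Skel.rootObl_of_rootOblT`).
[cite: KozmaNitzan2024, §4 p. 27 (G₀), p. 28 ((32) at the root), Lemma 11 (pp. 22–23), Lemma 12 (pp. 23–25)]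
-/

noncomputable section

open MeasureTheory ProbabilityTheory
open scoped ENNReal Classical

namespace Summit.CriticalPhenomena.PercolationContinuityZ3.Theorems

namespace Transplant

namespace Skelφ

open Literature.Probability.Percolation Literature.Probability.LatticeModels SimpleGraph KNCells KNLevels
open GadgetSystem ProbeHistory HSiteScheme Contour
open Skel (winGraph RootOblT rootObl_of_rootOblT)

variable {V : Type} [DecidableEq V] (G : SimpleGraph V) [G.LocallyFinite]
variable {A : Type*}

/-! ## §1 The root probe residue in schedule-chain form -/

/-- **The root obligation in SCHEDULE-CHAIN form** (D8 under D″): for every direction `du` a window graph `winGraph G c Rπ`, a planar window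
`𝒲` over it, a planar schedule `Sc` and window-chain data `P` with source the scheme's root; a sub-world `U' ⊆ Q_0 ∪ E_{0,du}` containing the
root, under the root law cut to `U'` (`W0sub`): `Rlev + 1 ≤ R'`, the rim parts inside the regions, nonempty true targets, per step `k ≤ Sc.N` the
subbox property in the window graph, the support facts, the source off the region, Step II's count and the per-level kit clause at accuracy
`δr Sc.N` towards the enlarged target `coreE k` inside `stepD k`, the rim excess `≤ η ≤ δr Sc.N / 2`; the first hop `1 − δr Sc.N < P(root ↔ B₀)`
towards some `B₀ ⊆ X^{(0)}_0`; and the last core `coreT Sc.N` inside `M_{a₀}(0 + du)`.  Schedule-chain twin of `Skel.RootOblA` / `Skel.RootOblT`.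
[this work] [cite: KozmaNitzan2024, §4 p. 27 (G₀), p. 28 ((32) at the root), Lemma 11 (pp. 22–23)] -/
def RootOblS (S : KSchA V A) (Δ' : ℕ) (δr : ℕ → ℝ) : Prop :=
  ∀ du : MDir, ∃ (c : V) (Rπ : ℕ) (𝒲 : PlanarWindow (winGraph G c Rπ)) (Sc : ChainPlanar.Schedule) (P : WinChainData V)
    (U' B₀ : Finset V) (η : ℝ),
    P.Rlev + 1 ≤ Sc.R' ∧ (∀ k, P.Rim k ⊆ 𝒲.stepD Sc k) ∧ (∀ k ≤ Sc.N, (𝒲.coreT Sc k).Nonempty) ∧ P.o = S.Γ.root ∧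
    U' ⊆ S.U0root du ∧ S.Γ.root ∈ U' ∧
    (∀ k ≤ Sc.N, IsSubbox (winGraph G c Rπ) (S.W0sub G U') S.p (𝒲.stepD Sc k)) ∧
    FinSupp (S.W0sub G U') P.Sfin ∧ (∀ k ≤ Sc.N, 𝒲.stepD Sc k ⊆ P.Sfin) ∧ (∀ k ≤ Sc.N, P.o ∉ 𝒲.stepD Sc k) ∧
    P.o ∈ P.Sfin ∧ P.j₁ ≤ P.Rlev ∧
    1 / (1 - (S.p : ℝ)) ^ (Δ' * P.N) ≤ δr Sc.N * ((Finset.Icc P.j₀ P.j₁).card : ℝ) ∧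
    (∀ k ≤ Sc.N, ∀ j ∈ Finset.Icc P.j₀ P.j₁, ∃ (σ : SData V) (Sz : Finset V),
      SHyp (P.stepL 𝒲 Sc k) j σ ∧ σ.N ≤ P.N ∧
      (1 - (S.p : ℝ) ^ σ.sB) ^ σ.k ≤ δr Sc.N ∧ Sz ⊆ (P.stepL 𝒲 Sc k).X j ∧ Sz ⊆ 𝒲.stepD Sc k ∧
      (∀ x ∈ σ.K, ∀ e' ∈ σ.seed x, e' ∉ wireSet (↑Sz : Set V)) ∧ (∀ x ∈ σ.K, σ.face x ⊆ Sz) ∧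
      (∀ x ∈ σ.K, 1 - 3 * δr Sc.N ≤ (prodBernoulli (S.W0sub G U')).real {ω | ∃ u ∈ σ.face x,
        1 - δr Sc.N < (prodBernoulli (pinW (S.W0sub G U') (wireSet (↑Sz : Set V)) ω)).real
          (⋃ t ∈ P.coreE 𝒲 Sc k, openConnIn (↑(𝒲.stepD Sc k) : Set V) u t)})) ∧
    η ≤ δr Sc.N / 2 ∧
    (∀ k ≤ Sc.N, (prodBernoulli (S.W0sub G U')).real (⋃ t ∈ P.Rim k, openConn S.Γ.root t) ≤ η) ∧
    B₀ ⊆ (P.stepL 𝒲 Sc 0).X 0 ∧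
    1 - δr Sc.N < (prodBernoulli (S.W0sub G U')).real (⋃ t ∈ B₀, openConn S.Γ.root t) ∧
    𝒲.coreT Sc Sc.N ⊆ S.Γ.M S.Γ.a₀ ((0 : Site 2) + stepVec du)

variable {G}

/-! ## §2 Repackaging into the node-facing residue -/

/-- **`RootOblS ⟹ RootOblT`** (pure repackaging: the schedule chain as a `Fin (Sc.N + 1)`-indexed linked chain of target steps
`P.stepA 𝒲 Sc k` in the window graph `winGraph G c Rπ`, true targets `𝒲.coreT Sc k` inside the enlarged `P.coreE 𝒲 Sc k`,
`WinChainData.kitsAt_stepA`, the rim bound, the first hop into `B₀ ⊆ X^{(0)}_0`).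
[cite: KozmaNitzan2024, §4 p. 28 ((32) at the root), Lemma 11 (pp. 22–23)] -/
theorem rootOblT_of_rootOblS [Countable V] {S : KSchA V A} {Δ' : ℕ} {δr : ℕ → ℝ} (hA : RootOblS G S Δ' δr) :
    RootOblT G S Δ' δr := by
  intro du
  obtain ⟨c, Rπ, 𝒲, Sc, P, U', B₀, η, hRl, hRim, hTne, hroot, hU', hrU, hsub, hfin, hDS, ho, hoS, hj, hcount, hkits, hη, hexc, hB₀,
    hsrc, hTn⟩ := hA du
  have hle : ∀ i : Fin (Sc.N + 1), (i : ℕ) ≤ Sc.N := fun i => Nat.lt_succ_iff.1 i.2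
  refine ⟨Sc.N, c, Rπ, U', fun i => P.stepA 𝒲 Sc i, fun i => 𝒲.coreT Sc i, η, hU', hrU, fun i => ?_, fun i => ?_,
    fun i => P.coreT_subset_coreE 𝒲 Sc i, fun i => ?_, hη, fun i => ?_, ?_, ?_⟩
  · rw [WinChainData.stepA_o, hroot]
  · -- the true targets link the chain
    show 𝒲.coreT Sc (Fin.castSucc i) ⊆ (P.stepA 𝒲 Sc i.succ).L.X 0
    have : ((i.succ : Fin (Sc.N + 1)) : ℕ) = (Fin.castSucc i : ℕ) + 1 := by simp
    rw [show P.stepA 𝒲 Sc (i.succ : ℕ) = P.stepA 𝒲 Sc ((Fin.castSucc i : ℕ) + 1) by rw [this]]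
    exact P.coreT_subset_X_zero_succ 𝒲 Sc _
  · exact P.kitsAt_stepA 𝒲 Sc hRl hRim (hle i) (hTne i (hle i)) (hsub i (hle i)) hfin (hDS i (hle i)) (ho i (hle i)) hoS hj hcount
      (hkits i (hle i))
  · -- the excess of the enlarged target is inside the rim part
    refine le_trans (measureReal_mono ?_ (measure_ne_top _ _)) (hexc i (hle i))
    intro ω hω
    simp only [Set.mem_iUnion, exists_prop] at hω ⊢
    obtain ⟨t, ht, hωt⟩ := hω
    exact ⟨t, P.coreE_sdiff_subset 𝒲 Sc i ht, hωt⟩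
  · -- the first hop: `B₀ ⊆ X^{(0)}_0`
    show 1 - δr Sc.N < (prodBernoulli (S.W0sub G U')).real (P.stepA 𝒲 Sc ((0 : Fin (Sc.N + 1)) : ℕ)).L.reachB
    rw [Fin.val_zero]
    refine hsrc.trans_le (measureReal_mono ?_ (measure_ne_top _ _))
    intro ω hω
    simp only [Set.mem_iUnion, exists_prop] at hω
    obtain ⟨t, ht, hωt⟩ := hω
    show ω ∈ (P.stepL 𝒲 Sc 0).reachB
    rw [← hroot] at hωt
    exact Set.mem_biUnion (Finset.mem_coe.2 (hB₀ ht)) hωt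
  · -- the last core lies in `M_{a₀}(0 + du)`
    show 𝒲.coreT Sc ((Fin.last Sc.N : Fin (Sc.N + 1)) : ℕ) ⊆ S.Γ.M S.Γ.a₀ ((0 : Site 2) + stepVec du)
    rw [Fin.val_last]; exact hTn

/-- **`RootOblS` + the chain property of every length at `(δr n ↦ δc)` for every window graph ⟹ the root conjunct (32) of `KitAtRun`**
(`Skel.rootObl_of_rootOblT ∘ rootOblT_of_rootOblS`). [cite: KozmaNitzan2024, §4 p. 28 ((32) at the root), Lemma 12 (pp. 23–25)] -/
theorem rootObl_of_rootOblS [Countable V] {S : KSchA V A} {Δ' : ℕ} {δr : ℕ → ℝ}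
    (hchain : ∀ (n : ℕ) (c : V) (Rπ : ℕ) (Wg : Sym2 V → unitInterval) (s : Fin (n + 1) → TStep (winGraph G c Rπ))
      (T' : Fin (n + 1) → Finset V) (η : ℝ),
      (∀ i : Fin (n + 1), (s i).L.o = (s 0).L.o) →
      (∀ i : Fin n, T' (Fin.castSucc i) ⊆ (s i.succ).L.X 0) →
      (∀ i : Fin (n + 1), T' i ⊆ (s i).T) →
      (∀ i : Fin (n + 1), (s i).KitsAt Wg S.p Δ' (δr n)) →
      η ≤ δr n / 2 →
      (∀ i : Fin (n + 1), (prodBernoulli Wg).real (⋃ t ∈ (s i).T \ T' i, openConn (s 0).L.o t) ≤ η) →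
      1 - δr n < (prodBernoulli Wg).real (s 0).L.reachB →
        1 - S.δc < (prodBernoulli Wg).real (⋃ t ∈ T' (Fin.last n), openConn (s 0).L.o t))
    (hA : RootOblS G S Δ' δr) :
    ∀ du : MDir, 1 - S.δc < (prodBernoulli (pinW (lattW G S.p) ↑(S.U₀ G) ↑(S.U₀ G))).real
      (⋃ t ∈ (↑(S.Γ.M S.Γ.a₀ ((0 : Site 2) + stepVec du)) : Set V),
        openConnIn (↑(S.Γ.Q S.Γ.a₀ 0 ∪ S.Γ.Ewv S.Γ.a₀ 0 du) : Set V) S.Γ.root t) :=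
  rootObl_of_rootOblT hchain (rootOblT_of_rootOblS hA)

end Skelφ

end Transplant

end Summit.CriticalPhenomena.PercolationContinuityZ3.Theorems

end
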